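import Summits.Ventures.Crystal3D.Theorems.StickyWulffConstantGenericWallFloorStackLedgerLocalTools
import Summits.Ventures.Crystal3D.Theorems.StickyWulffConstantGenericWallFloorStackWalkFrames
import HarnessLib

/-!
# The count at one end ball: `deg y + #(end states at y) ≤ 12` for non-chain pairs (crux `GenericWallFloor`,
# line `WallLedgerG`; sixth brick of the MERGE LOCALISATION of the stack ledger's residual `LOST`)

HONEST FRAMING. Part of the venture `Summits/Ventures/Crystal3D` (cell `crystal3d-full`), helper
`--supports` the crux `GenericWallFloor` (stmt-Ventures-19480) of `route-Ventures-StickyWulffConstant`,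
registered line `WallLedgerG`, open stub `stub_twoSlabAdhesion` (general fillings).  Puts the bricks together
at ONE ball `y`: given the grain-1 and grain-2 END STATES at `y` (valid, well-formed, strongly certified, with
their grain's bottom entry, frames in the grain's mirror-closed family — 19480-p1's non-chain families
`𝓕₁ ∌ A₂·Λ₀`, `𝓕₂ ∌ A₁·Λ₀`), any two of them have NON-co-axial top lattices (`not_coaxial_of_two_states` within
a grain, `not_coaxial_of_family_stack` across), so under the double-star inputs `DoubleStarCoaxialAt` (R39d,
certified) and `CapPairCoaxial` (R39e, named) their closed stars pairwise cover the contacts of `y` and are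
pairwise different, and `card_contacts_add_card_le_twelve` gives

  **`card_contacts_add_endStates_le_twelve`**: `deg y + #ES₁ + #ES₂ ≤ 12`.

Also: `topPair` (top frame and direction of a state), `walkRun_certified12` (the strong certificate along a run).

WHAT THIS IS NOT: not the stub; the inputs `ExactOnly` (C12-55), `DoubleStarCoaxialAt`, `CapPairCoaxial`
remain; the two-slab inequality itself is the next file; F-C1 not moved.
-/

noncomputable section

namespace Summit.Ventures.Crystal3D.Theorems

open Finset
open Literature.MathematicalPhysics.StatisticalMechanics (fccStacking barlowStacking IsHaggSeq)
open scoped InnerProductSpace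

variable {X : Finset (EuclideanSpace ℝ (Fin 3))}

/-! ### The top pair of a state and the strong certificate along a run -/

/-- The TOP PAIR (frame, direction) of a walker state (a junk value for the empty stack). -/
def topPair : EuclideanSpace ℝ (Fin 3) × List WalkEntry →
    (EuclideanSpace ℝ (Fin 3) ≃ₗᵢ[ℝ] EuclideanSpace ℝ (Fin 3)) × EuclideanSpace ℝ (Fin 3)
  | (_, []) => (LinearIsometryEquiv.refl ℝ _, 0)
  | (_, e :: _) => (e.frame, e.dir)

/-- The top pair of a state with top entry `e`. -/
theorem topPair_eq {s : EuclideanSpace ℝ (Fin 3) × List WalkEntry} {e : WalkEntry} {rest : List WalkEntry}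
    (h : s.2 = e :: rest) : topPair s = (e.frame, e.dir) := by
  obtain ⟨y, stk⟩ := s
  simp only at h
  subst h
  rfl

/-- The strong certificate only sees the frame and the direction. -/
theorem WalkCertified12.eta {y : EuclideanSpace ℝ (Fin 3)} {e : WalkEntry} (h : WalkCertified12 X y e) :
    WalkCertified12 X y ⟨e.frame, e.dir, 0⟩ := h

/-- **The strong certificate is carried along a run** (from a strongly certified start). -/
theorem walkRun_certified12 (hX : ∀ p ∈ X, ∀ q ∈ X, p ≠ q → 1 ≤ dist p q)
    {s₀ : EuclideanSpace ℝ (Fin 3)} (hs₀ : s₀ ∈ fccSlots)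
    (hcert : ExactOnly 0 (fccSlots.filter fun w => 0 < ⟪w, s₀⟫_ℝ))
    {z : EuclideanSpace ℝ (Fin 3)} (hz : ‖z‖ = 1) {s : EuclideanSpace ℝ (Fin 3) × List WalkEntry}
    (hI : WalkInv X z s) (h0 : ∃ e rest, s.2 = e :: rest ∧ WalkCertified12 X s.1 e) :
    ∀ k : ℕ, ∃ e rest, (walkRun X z k s).2 = e :: rest ∧ WalkCertified12 X (walkRun X z k s).1 e := by
  intro k
  induction k with
  | zero => exact h0
  | succ k IH =>
    rw [walkRun_succ']
    have hIk := (walkRun_spec hX hs₀ hcert hz k s hI).1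
    cases hst : walkStep X z (walkRun X z k s) with
    | none => rw [walkRun_succ_of_none X z 0 hst]; exact IH
    | some v => rw [walkRun_succ_of_some X z 0 hst, walkRun_zero]; exact walkStep_certified12 hIk hst

/-- Equal linear lattices are co-axial (linear form). -/
theorem coaxial_linear_of_image_eq {F₁ F₂ : EuclideanSpace ℝ (Fin 3) ≃ₗᵢ[ℝ] EuclideanSpace ℝ (Fin 3)}
    (h : F₁ '' fccStacking 1 (Real.sqrt (2 / 3)) = F₂ '' fccStacking 1 (Real.sqrt (2 / 3))) :
    ∃ (L : EuclideanSpace ℝ (Fin 3) ≃ₗᵢ[ℝ] EuclideanSpace ℝ (Fin 3))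
      (s₁ s₂ : EuclideanSpace ℝ (Fin 3)) (σ σ' : ℤ → ℤ), IsHaggSeq σ ∧ IsHaggSeq σ' ∧
      F₁ '' fccStacking 1 (Real.sqrt (2 / 3)) ⊆ (fun p => L p + s₁) '' barlowStacking 1 (Real.sqrt (2 / 3)) σ ∧
      F₂ '' fccStacking 1 (Real.sqrt (2 / 3)) ⊆ (fun p => L p + s₂) '' barlowStacking 1 (Real.sqrt (2 / 3)) σ' := by
  have hσ : IsHaggSeq (fun _ : ℤ => (1 : ℤ)) := fun _ => Or.inl rfl
  have hsub : F₁ '' fccStacking 1 (Real.sqrt (2 / 3)) ⊆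
      (fun p => F₁ p + 0) '' barlowStacking 1 (Real.sqrt (2 / 3)) (fun _ : ℤ => (1 : ℤ)) := by
    rintro _ ⟨q, hq, rfl⟩; exact ⟨q, hq, by simp⟩
  exact ⟨F₁, 0, 0, _, _, hσ, hσ, hsub, by rw [← h]; exact hsub⟩

/-! ### The inner sample is an interval along lattice lines -/

/-- **Interval property of the inner sample.**  `P` the complete sample of `Λ = A·Λ₀ + t₀` in
`[a, b] × disc ρ`, `S ⊆ P` its part in `[lo, hi] × disc ρs` (`a ≤ lo`, `hi ≤ b`, `0 ≤ ρs ≤ ρ`), `u` a slot.  If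
`p ∈ S` and `p + i·A u ∈ S` for some `i ≥ 1` then `p + A u ∈ S` (heights are monotone along the line and the
squared lateral radius is convex). -/
theorem sample_interval (A : EuclideanSpace ℝ (Fin 3) ≃ₗᵢ[ℝ] EuclideanSpace ℝ (Fin 3)) (t₀ : EuclideanSpace ℝ (Fin 3))
    (P S : Finset (EuclideanSpace ℝ (Fin 3))) {a b ρ lo hi ρs : ℝ} (hρs : 0 ≤ ρs) (hρsρ : ρs ≤ ρ)
    (hlo : a ≤ lo) (hhi : hi ≤ b)
    (hP : ∀ p, p ∈ P ↔ (p ∈ (fun q => A q + t₀) '' fccStacking 1 (Real.sqrt (2 / 3)) ∧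
      a ≤ p 2 ∧ p 2 ≤ b ∧ p 0 ^ 2 + p 1 ^ 2 ≤ ρ ^ 2))
    (hS : ∀ p, p ∈ S ↔ (p ∈ P ∧ lo ≤ p 2 ∧ p 2 ≤ hi ∧ p 0 ^ 2 + p 1 ^ 2 ≤ ρs ^ 2))
    {u : EuclideanSpace ℝ (Fin 3)} (hu : u ∈ fccSlots) :
    ∀ p ∈ S, ∀ i : ℕ, 1 ≤ i → p + ((i : ℕ) : ℝ) • A u ∈ S → p + A u ∈ S := by
  intro p hp i hione hpi
  obtain ⟨hpP, hp1, hp2, hp3⟩ := (hS p).1 hp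
  obtain ⟨hpΛ, -, -, -⟩ := (hP p).1 hpP
  obtain ⟨-, hq1, hq2, hq3⟩ := (hS _).1 hpi
  have hi1 : (1 : ℝ) ≤ (i : ℝ) := by exact_mod_cast hione
  -- coordinates along the line
  have e2 : (p + A u) 2 = p 2 + (A u) 2 := by simp
  have e2i : (p + ((i : ℕ) : ℝ) • A u) 2 = p 2 + (i : ℝ) * (A u) 2 := by simp
  have e0 : (p + A u) 0 = p 0 + (A u) 0 := by simp
  have e1 : (p + A u) 1 = p 1 + (A u) 1 := by simp
  have e0i : (p + ((i : ℕ) : ℝ) • A u) 0 = p 0 + (i : ℝ) * (A u) 0 := by simp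
  have e1i : (p + ((i : ℕ) : ℝ) • A u) 1 = p 1 + (i : ℝ) * (A u) 1 := by simp
  rw [e2i] at hq1 hq2
  rw [e0i, e1i] at hq3
  -- heights between, radius by convexity
  have hh1 : lo ≤ p 2 + (A u) 2 := by
    rcases le_or_gt 0 ((A u) 2) with h | h
    · linarith
    · nlinarith
  have hh2 : p 2 + (A u) 2 ≤ hi := by
    rcases le_or_gt 0 ((A u) 2) with h | h
    · nlinarith
    · linarith
  have hr : (p 0 + (A u) 0) ^ 2 + (p 1 + (A u) 1) ^ 2 ≤ ρs ^ 2 := by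
    have key : (i : ℝ) * ((p 0 + (A u) 0) ^ 2 + (p 1 + (A u) 1) ^ 2) +
        (i : ℝ) * ((i : ℝ) - 1) * ((A u) 0 ^ 2 + (A u) 1 ^ 2) =
        ((i : ℝ) - 1) * (p 0 ^ 2 + p 1 ^ 2) + ((p 0 + (i : ℝ) * (A u) 0) ^ 2 + (p 1 + (i : ℝ) * (A u) 1) ^ 2) := by
      ring
    have h1 : (i : ℝ) * ((p 0 + (A u) 0) ^ 2 + (p 1 + (A u) 1) ^ 2) ≤ (i : ℝ) * ρs ^ 2 := by
      have ha : ((i : ℝ) - 1) * (p 0 ^ 2 + p 1 ^ 2) ≤ ((i : ℝ) - 1) * ρs ^ 2 :=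
        mul_le_mul_of_nonneg_left hp3 (by linarith)
      have hb : 0 ≤ (i : ℝ) * ((i : ℝ) - 1) * ((A u) 0 ^ 2 + (A u) 1 ^ 2) :=
        mul_nonneg (mul_nonneg (by linarith) (by linarith)) (by positivity)
      nlinarith [key, ha, hb, hq3]
    exact le_of_mul_le_mul_left h1 (by linarith)
  have hΛ : p + A u ∈ (fun q => A q + t₀) '' fccStacking 1 (Real.sqrt (2 / 3)) := by
    obtain ⟨q, hq, hqp⟩ := hpΛ
    refine ⟨q + u, fcc_add_site_mem hq (mem_fcc_of_mem_fccSlots hu), ?_⟩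
    simp only at hqp
    show A (q + u) + t₀ = p + A u
    rw [← hqp, map_add]; abel
  have hρρ : ρs ^ 2 ≤ ρ ^ 2 := pow_le_pow_left₀ hρs hρsρ 2
  refine (hS _).2 ⟨(hP _).2 ⟨hΛ, ?_, ?_, ?_⟩, ?_, ?_, ?_⟩
  · rw [e2]; linarith
  · rw [e2]; linarith
  · rw [e0, e1]; exact hr.trans hρρ
  · rw [e2]; exact hh1
  · rw [e2]; exact hh2
  · rw [e0, e1]; exact hr

/-! ### The count at one ball -/

open scoped Classical in
/-- **`deg y + #(end states at y) ≤ 12` (non-chain pairs).**  See the module docstring.  `ES₁`, `ES₂` are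
finite sets of walker states AT `y` of grain 1 (vertical `z₁`, bottom entry `b₁`, frames in `𝓕₁`) and of
grain 2 (`z₂`, `b₂ ≠ b₁`, frames in `𝓕₂`), each satisfying `WalkInv`, `StackWF` and carrying the strong
certificate; `y` has at most eleven contacts.  Inputs: `DoubleStarCoaxialAt` for all frame pairs and
`CapPairCoaxial`. -/
theorem card_contacts_add_endStates_le_twelve (hX : ∀ p ∈ X, ∀ q ∈ X, p ≠ q → 1 ≤ dist p q)
    (hDS : ∀ F₁ F₂ : EuclideanSpace ℝ (Fin 3) ≃ₗᵢ[ℝ] EuclideanSpace ℝ (Fin 3), DoubleStarCoaxialAt F₁ F₂)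
    (hCP : CapPairCoaxial)
    (𝓕₁ 𝓕₂ : Set (EuclideanSpace ℝ (Fin 3) ≃ₗᵢ[ℝ] EuclideanSpace ℝ (Fin 3)))
    (hclosed₁ : ∀ G ∈ 𝓕₁, ∀ m : EuclideanSpace ℝ (Fin 3), ‖m‖ = 1 →
      (∀ w ∈ fccSlots, ⟪G w, m⟫_ℝ = 0 ∨ ⟪G w, m⟫_ℝ = Real.sqrt (2 / 3) ∨ ⟪G w, m⟫_ℝ = -Real.sqrt (2 / 3)) →
      ∀ G' : EuclideanSpace ℝ (Fin 3) ≃ₗᵢ[ℝ] EuclideanSpace ℝ (Fin 3),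
        (∀ x, G' x = G x - (2 * ⟪G x, m⟫_ℝ) • m) → G' ∈ 𝓕₁)
    (hclosed₂ : ∀ G ∈ 𝓕₂, ∀ m : EuclideanSpace ℝ (Fin 3), ‖m‖ = 1 →
      (∀ w ∈ fccSlots, ⟪G w, m⟫_ℝ = 0 ∨ ⟪G w, m⟫_ℝ = Real.sqrt (2 / 3) ∨ ⟪G w, m⟫_ℝ = -Real.sqrt (2 / 3)) →
      ∀ G' : EuclideanSpace ℝ (Fin 3) ≃ₗᵢ[ℝ] EuclideanSpace ℝ (Fin 3),
        (∀ x, G' x = G x - (2 * ⟪G x, m⟫_ℝ) • m) → G' ∈ 𝓕₂)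
    {b₁ b₂ : WalkEntry} (hbb : b₁ ≠ b₂)
    (havoid₁ : ∀ G ∈ 𝓕₁, G '' fccStacking 1 (Real.sqrt (2 / 3)) ≠ b₂.frame '' fccStacking 1 (Real.sqrt (2 / 3)))
    (havoid₂ : ∀ G ∈ 𝓕₂, G '' fccStacking 1 (Real.sqrt (2 / 3)) ≠ b₁.frame '' fccStacking 1 (Real.sqrt (2 / 3)))
    {z₁ z₂ y : EuclideanSpace ℝ (Fin 3)} (hdeg : (X.filter fun q => dist y q = 1).card ≤ 11)
    (ES₁ ES₂ : Finset (EuclideanSpace ℝ (Fin 3) × List WalkEntry))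
    (h₁ : ∀ s ∈ ES₁, s.1 = y ∧ WalkInv X z₁ s ∧ StackWF z₁ s.2 ∧ s.2.getLast? = some b₁ ∧
      (∃ e rest, s.2 = e :: rest ∧ WalkCertified12 X y e) ∧ ∀ e ∈ s.2, e.frame ∈ 𝓕₁)
    (h₂ : ∀ s ∈ ES₂, s.1 = y ∧ WalkInv X z₂ s ∧ StackWF z₂ s.2 ∧ s.2.getLast? = some b₂ ∧
      (∃ e rest, s.2 = e :: rest ∧ WalkCertified12 X y e) ∧ ∀ e ∈ s.2, e.frame ∈ 𝓕₂) :
    (X.filter fun q => dist y q = 1).card + ES₁.card + ES₂.card ≤ 12 := by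
  -- shorthand for co-axiality of two frames
  let CoAx : (EuclideanSpace ℝ (Fin 3) ≃ₗᵢ[ℝ] EuclideanSpace ℝ (Fin 3)) →
      (EuclideanSpace ℝ (Fin 3) ≃ₗᵢ[ℝ] EuclideanSpace ℝ (Fin 3)) → Prop := fun F₁ F₂ =>
    ∃ (L : EuclideanSpace ℝ (Fin 3) ≃ₗᵢ[ℝ] EuclideanSpace ℝ (Fin 3))
      (s₁ s₂ : EuclideanSpace ℝ (Fin 3)) (σ σ' : ℤ → ℤ), IsHaggSeq σ ∧ IsHaggSeq σ' ∧
      F₁ '' fccStacking 1 (Real.sqrt (2 / 3)) ⊆ (fun p => L p + s₁) '' barlowStacking 1 (Real.sqrt (2 / 3)) σ ∧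
      F₂ '' fccStacking 1 (Real.sqrt (2 / 3)) ⊆ (fun p => L p + s₂) '' barlowStacking 1 (Real.sqrt (2 / 3)) σ'
  have hb₂eta : b₂ = ⟨b₂.frame, b₂.dir, b₂.nrm⟩ := by cases b₂; rfl
  have hb₁eta : b₁ = ⟨b₁.frame, b₁.dir, b₁.nrm⟩ := by cases b₁; rfl
  -- the key pairwise fact: different states at `y` have non-co-axial top frames
  have key : ∀ s ∈ ES₁ ∪ ES₂, ∀ s' ∈ ES₁ ∪ ES₂, s ≠ s' → ∀ e rest e' rest', s.2 = e :: rest → s'.2 = e' :: rest' →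
      ¬ CoAx e.frame e'.frame := by
    intro s hs s' hs' hne e rest e' rest' hse hse'
    rcases Finset.mem_union.1 hs with hs | hs <;> rcases Finset.mem_union.1 hs' with hs' | hs'
    · -- both of grain 1
      obtain ⟨hy, hI, hW, hlast, -, -⟩ := h₁ s hs
      obtain ⟨hy', hI', hW', hlast', -, -⟩ := h₁ s' hs'
      obtain ⟨hyX, hS, e₀, rest₀, hstk, hC⟩ := hI
      obtain ⟨-, hS', e₀', rest₀', hstk', hC'⟩ := hI'
      rw [hse] at hstk hS hW hlast; rw [hse'] at hstk' hS' hW' hlast'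
      injection hstk with he₀ _; injection hstk' with he₀' _
      subst he₀; subst he₀'
      rw [hy] at hC; rw [hy'] at hC'
      have hstne : e :: rest ≠ e' :: rest' := by
        intro h; apply hne; exact Prod.ext (by rw [hy, hy']) (by rw [hse, hse', h])
      exact not_coaxial_of_two_states hX hS hW hC hS' hW' hC' (hlast.trans hlast'.symm) hstne
    · -- grain 1 vs grain 2
      obtain ⟨-, -, -, -, -, hfam⟩ := h₁ s hs
      obtain ⟨-, hI', -, hlast', -, -⟩ := h₂ s' hs'
      obtain ⟨-, hS', -, -, -, -⟩ := hI'
      rw [hse'] at hS' hlast'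
      rw [hb₂eta] at hlast'
      exact not_coaxial_of_family_stack 𝓕₁ hclosed₁ havoid₁ ⟨e.frame, hfam e (by rw [hse]; simp), rfl⟩ hS' hlast'
    · -- grain 2 vs grain 1
      obtain ⟨-, -, -, -, -, hfam⟩ := h₂ s hs
      obtain ⟨-, hI', -, hlast', -, -⟩ := h₁ s' hs'
      obtain ⟨-, hS', -, -, -, -⟩ := hI'
      rw [hse'] at hS' hlast'
      rw [hb₁eta] at hlast'
      exact not_coaxial_of_family_stack 𝓕₂ hclosed₂ havoid₂ ⟨e.frame, hfam e (by rw [hse]; simp), rfl⟩ hS' hlast'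
    · -- both of grain 2
      obtain ⟨hy, hI, hW, hlast, -, -⟩ := h₂ s hs
      obtain ⟨hy', hI', hW', hlast', -, -⟩ := h₂ s' hs'
      obtain ⟨hyX, hS, e₀, rest₀, hstk, hC⟩ := hI
      obtain ⟨-, hS', e₀', rest₀', hstk', hC'⟩ := hI'
      rw [hse] at hstk hS hW hlast; rw [hse'] at hstk' hS' hW' hlast'
      injection hstk with he₀ _; injection hstk' with he₀' _
      subst he₀; subst he₀'
      rw [hy] at hC; rw [hy'] at hC'
      have hstne : e :: rest ≠ e' :: rest' := by
        intro h; apply hne; exact Prod.ext (by rw [hy, hy']) (by rw [hse, hse', h])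
      exact not_coaxial_of_two_states hX hS hW hC hS' hW' hC' (hlast.trans hlast'.symm) hstne
  -- uniform data for a state of either grain
  have hdata : ∀ s ∈ ES₁ ∪ ES₂, s.1 = y ∧ y ∈ X ∧ ∃ e rest, s.2 = e :: rest ∧ e.dir ∈ fccSlots ∧ WalkCertified12 X y e := by
    intro s hs
    rcases Finset.mem_union.1 hs with hs | hs
    · obtain ⟨hy, hI, -, -, ⟨e, rest, hse, hC⟩, -⟩ := h₁ s hs
      obtain ⟨hyX, hS, -⟩ := hI
      rw [hse] at hS; rw [hy] at hyX
      exact ⟨hy, hyX, e, rest, hse, hS.top.1, hC⟩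
    · obtain ⟨hy, hI, -, -, ⟨e, rest, hse, hC⟩, -⟩ := h₂ s hs
      obtain ⟨hyX, hS, -⟩ := hI
      rw [hse] at hS; rw [hy] at hyX
      exact ⟨hy, hyX, e, rest, hse, hS.top.1, hC⟩
  -- the two families of states are disjoint
  have hdisj : Disjoint ES₁ ES₂ := by
    rw [Finset.disjoint_left]
    intro s hs hs'
    obtain ⟨-, -, -, hl₁, -, -⟩ := h₁ s hs
    obtain ⟨-, -, -, hl₂, -, -⟩ := h₂ s hs'
    exact hbb (Option.some.inj (hl₁.symm.trans hl₂))
  -- the family of top pairs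
  set 𝓟 := (ES₁ ∪ ES₂).image topPair with h𝓟
  have hinj : Set.InjOn topPair ↑(ES₁ ∪ ES₂) := by
    intro s hs s' hs' h
    by_contra hne
    obtain ⟨-, -, e, rest, hse, -, -⟩ := hdata s hs
    obtain ⟨-, -, e', rest', hse', -, -⟩ := hdata s' hs'
    rw [topPair_eq hse, topPair_eq hse'] at h
    injection h with hf _
    exact key s hs s' hs' hne e rest e' rest' hse hse' (coaxial_linear_of_image_eq (by rw [hf]))
  have hcard : 𝓟.card = ES₁.card + ES₂.card := by
    rw [h𝓟, Finset.card_image_of_injOn hinj, Finset.card_union_of_disjoint hdisj]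
  -- members of `𝓟` come with their state
  have hmem : ∀ p ∈ 𝓟, ∃ s ∈ ES₁ ∪ ES₂, ∃ e rest, s.2 = e :: rest ∧ e.dir ∈ fccSlots ∧ WalkCertified12 X y e ∧
      p = (e.frame, e.dir) := by
    intro p hp
    obtain ⟨s, hs, rfl⟩ := Finset.mem_image.1 hp
    obtain ⟨-, -, e, rest, hse, hdir, hC⟩ := hdata s hs
    exact ⟨s, hs, e, rest, hse, hdir, hC, topPair_eq hse⟩
  have hyX : ∀ p ∈ 𝓟, y ∈ X := by
    intro p hp
    obtain ⟨s, hs, rfl⟩ := Finset.mem_image.1 hp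
    exact (hdata s hs).2.1
  -- pairwise non-co-axiality for pairs
  have keyP : ∀ p ∈ 𝓟, ∀ p' ∈ 𝓟, p ≠ p' → ¬ CoAx p.1 p'.1 := by
    intro p hp p' hp' hne
    obtain ⟨s, hs, rfl⟩ := Finset.mem_image.1 hp
    obtain ⟨s', hs', rfl⟩ := Finset.mem_image.1 hp'
    have hss : s ≠ s' := fun h => hne (by rw [h])
    obtain ⟨-, -, e, rest, hse, -, -⟩ := hdata s hs
    obtain ⟨-, -, e', rest', hse', -, -⟩ := hdata s' hs'
    rw [topPair_eq hse, topPair_eq hse']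
    exact key s hs s' hs' hss e rest e' rest' hse hse'
  have hmain := card_contacts_add_card_le_twelve hdeg 𝓟 (fun p hp => ?_) (fun p hp => ?_) (fun p hp p' hp' hne => ?_)
    (fun p hp p' hp' hne => ?_)
  · rw [hcard] at hmain; omega
  · obtain ⟨s, hs, e, rest, hse, hdir, hC, rfl⟩ := hmem p hp
    exact hdir
  · obtain ⟨s, hs, e, rest, hse, hdir, hC, rfl⟩ := hmem p hp
    exact star_owned_of_walkCertified hdir hC.walkCertified
  · -- different stars: equal stars would make the top lattices co-axial
    intro hEq
    have hnc := keyP p hp p' hp' hne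
    obtain ⟨s, hs, e, rest, hse, hdir, hC, rfl⟩ := hmem p hp
    exact hnc (coaxial_of_starSet_eq hdir hEq)
  · -- covering: an eleventh contact off both stars would make the top lattices co-axial (the inputs)
    intro q hq hqd
    by_contra hnot
    rw [Finset.mem_union, not_or] at hnot
    have hnc := keyP p hp p' hp' hne
    have hy := hyX p hp
    obtain ⟨s, hs, e, rest, hse, hdir, hC, rfl⟩ := hmem p hp
    obtain ⟨s', hs', e', rest', hse', hdir', hC', rfl⟩ := hmem p' hp'
    have hoff : ∀ (F : EuclideanSpace ℝ (Fin 3) ≃ₗᵢ[ℝ] EuclideanSpace ℝ (Fin 3)) (v : EuclideanSpace ℝ (Fin 3)),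
        q ∉ starSet y F v → ∀ w ∈ fccSlots, ⟪w, v⟫_ℝ < 0 → q ≠ y + F w := by
      intro F v hq' w hw hneg hqw
      apply hq'
      unfold starSet
      exact Finset.mem_image.2 ⟨w, Finset.mem_filter.2 ⟨hw, hneg⟩, hqw.symm⟩
    exact hnc (coaxial_of_pair_certified hX (hDS e.frame e'.frame) hCP hdir hdir' hy hC.eta hC'.eta hq hqd
      (hoff e.frame e.dir hnot.1) (hoff e'.frame e'.dir hnot.2))

end Summit.Ventures.Crystal3D.Theorems

end
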